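import Mathlib
import Summits.ValiantsHypothesis.ValiantsHypothesis.Theses.GrenetZeon
import Summits.ValiantsHypothesis.ValiantsHypothesis.Theorems.GrenetZeonTwoDimCoefficientsDefs
import Summits.ValiantsHypothesis.ValiantsHypothesis.Theorems.GrenetZeonTwoDimCoefficientsStubClassify
import Summits.ValiantsHypothesis.ValiantsHypothesis.Theorems.GrenetZeonTwoDimCoefficientsStubSplitCase
import Summits.ValiantsHypothesis.ValiantsHypothesis.Theorems.GrenetZeonTwoDimCoefficientsStubDualCase
import Summits.ValiantsHypothesis.ValiantsHypothesis.Theorems.GrenetZeonTwoDimCoefficientsDualUnipotentCalibration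
import Summits.ValiantsHypothesis.ValiantsHypothesis.Theorems.GrenetZeonTwoDimCoefficientsStubUnitDichotomy
import Literature.Computability.AlgebraicComplexity.LandsbergRessayreNormalForm
import Literature.LinearAlgebra.Matrix.MvPolynomialDetDegree
import Literature.Computability.AlgebraicComplexity.StandardFamiliesProofs

/-!
# Crux `GrenetZeon.TwoDimCoefficients` (stmt-ValiantsHypothesis-8062), line `dim2_cases`:
# what the line proves WITHOUT the open stub `stub_dualUnipotent`

The registered composition `TwoDimCoefficients_of` of the line `dim2_cases` consumes five stubs; four
are tree theorems or in hand (`stub_classify`, `stub_splitCase`, `stub_dualCase` landed by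
val-width-8062-p1 and -p2; `stub_unitDichotomy` = `UnitDichotomy`, taken here as a hypothesis), and the
fifth, `stub_dualUnipotent : DualUnipotentBound`, is open-problem grade (calibration:
`GrenetZeonTwoDimCoefficientsDualUnipotentCalibration`, `…HessianBlind`,
`Cruxes/TwoDimCoefficients/CALIBRATION-stub_dualUnipotent.md`).  This file records, as tree theorems
conditional on the dependency crux `HessianRankCodimTwo` (stmt-8061, BY NAME, exactly as in the
composition) and on `UnitDichotomy`, the two honest forms of the crux that do NOT need the open stub:

* `hasDim2Repr_sq_le_or_unipotent` — DISJUNCTIVE form: every `(m, ≤ 2)`-representation of `per_n`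
  (`n ≥ n₀`) satisfies `n² ≤ C·m` OR is a unipotent dual representation (`DualUnipotentRepr n m`:
  `per_n = α det A + β tr(adj A·B)` with `det A` a non-zero constant);
* `hasDim2Repr_linearBound` — LINEAR form: every `(m, ≤ 2)`-representation of `per_n` (`n ≥ n₀`)
  satisfies `n ≤ C·m` (the unipotent branch contributes `n ≤ 2m` through the `m² + 1` transfer
  `dualUnipotentRepr_linearBound`).

and the glue `twoDimCoefficients_of_disjunctive`: the disjunctive form plus `DualUnipotentBound` give
the crux verbatim (so re-typing the crux to either form above loses nothing already proved).

HONEST FRAMING: bookkeeping over landed stubs; conditional on `HessianRankCodimTwo` (open route item)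
and `UnitDichotomy` (stub in progress); the quadratic bound in the unipotent sub-case stays open;
`VP ≠ VNP` is not moved.
-/

-- single-conjunct layout `Summits/ValiantsHypothesis/ValiantsHypothesis`: the duplicated namespace
-- component is mandated by the tree.
set_option linter.dupNamespace false

noncomputable section

namespace Summit.ValiantsHypothesis.ValiantsHypothesis.Cruxes.TwoDimCoefficients.DimTwoCases

open MvPolynomial Matrix
open Literature.Computability.AlgebraicComplexity
open Summit.ValiantsHypothesis.ValiantsHypothesis.Theses.GrenetZeon

/-- **Dual shape, disjunctive form** (the proof of `stub_dualCase` with its third hypothesis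
removed): given `HessianRankCodimTwo` and `UnitDichotomy`, a DUAL representation
`per_n = α det A + β tr(adj A·B)` of size `m` (`n ≥ n₀`) has `n² ≤ 12·m` unless `det A` is a non-zero
constant, in which case it is a `DualUnipotentRepr`. [folklore] -/
theorem dualRepr_sq_le_or_unipotent (hH : HessianRankCodimTwo) (hU : UnitDichotomy) :
    ∃ C n₀ : ℕ, ∀ n ≥ n₀, ∀ m : ℕ, DualRepr n m → n ^ 2 ≤ C * m ∨ DualUnipotentRepr n m := by
  obtain ⟨nH, hH⟩ := hH
  refine ⟨12, max nH 3, fun n hn m hS => ?_⟩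
  have hnH : nH ≤ n := (le_max_left _ _).trans hn
  have hn3 : 3 ≤ n := (le_max_right _ _).trans hn
  have hn1 : 1 ≤ n := by omega
  have h9 : 9 ≤ n ^ 2 := by
    calc (9 : ℕ) = 3 ^ 2 := by norm_num
      _ ≤ n ^ 2 := Nat.pow_le_pow_left hn3 2
  obtain ⟨α, β, A, B, hA, hB, hper⟩ := hS
  -- Case 1: a common zero of `per_n` and `det A`.
  by_cases hZ : ∃ p : Fin n × Fin n → ℂ, eval p (perPoly (Fin n) ℂ) = 0 ∧ eval p A.det = 0
  · obtain ⟨p, hp, hpA, hrank⟩ := hH n hnH A.det hZ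
    have hle := DualCase.rank_hess0_transl_perPoly_le_of_dual hA hB hper p hp hpA
    left
    omega
  -- Case 2: no common zero: unit dichotomy for `A`.
  push Not at hZ
  rcases hU n hn3 m A hA (fun p hp => hZ p hp) with ⟨c, hc⟩ | hle
  swap
  · left
    omega
  -- `det A = c` with `c ≠ 0` (the origin is a zero of `per_n`): the isolated unipotent sub-case.
  right
  have hc0 : c ≠ 0 := by
    have h := hZ 0 (by rw [MvPolynomial.eval_zero]; exact constantCoeff_perPoly ℂ hn1)
    rw [hc, eval_C] at h
    exact h
  exact ⟨α, β, c, A, B, hA, hB, hc0, hc, hper⟩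

/-- **The crux in DISJUNCTIVE form, without the open stub.** Given `HessianRankCodimTwo` (stmt-8061)
and `UnitDichotomy`: there are `C`, `n₀` such that every `(m, ≤ 2)`-representation of `per_n`,
`n ≥ n₀`, has `n² ≤ C·m` or is a unipotent dual representation. [folklore] -/
theorem hasDim2Repr_sq_le_or_unipotent (hH : HessianRankCodimTwo) (hU : UnitDichotomy) :
    ∃ C n₀ : ℕ, ∀ n ≥ n₀, ∀ m : ℕ, HasDim2Repr n m → n ^ 2 ≤ C * m ∨ DualUnipotentRepr n m := by
  obtain ⟨C₁, n₁, h₁⟩ := stub_splitCase hH hU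
  obtain ⟨C₂, n₂, h₂⟩ := dualRepr_sq_le_or_unipotent hH hU
  refine ⟨max C₁ C₂, max n₁ n₂, fun n hn m hrep => ?_⟩
  rcases stub_classify n m hrep with hs | hd
  · exact Or.inl ((h₁ n (le_of_max_le_left hn) m hs).trans
      (Nat.mul_le_mul_right _ (le_max_left _ _)))
  · rcases h₂ n (le_of_max_le_right hn) m hd with h | h
    · exact Or.inl (h.trans (Nat.mul_le_mul_right _ (le_max_right _ _)))
    · exact Or.inr h

/-- **The crux in LINEAR form, without the open stub.** Given `HessianRankCodimTwo` (stmt-8061) and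
`UnitDichotomy`: there are `C`, `n₀` such that every `(m, ≤ 2)`-representation of `per_n`, `n ≥ n₀`,
has `n ≤ C·m` — "two-dimensional coefficients buy at most a linear factor".  The unipotent branch is
`dualUnipotentRepr_linearBound` (`n ≤ 2m`, from `dc ≤ m² + 1` and Mignon–Ressayre).
[cite: MignonRessayre2004, Thm. 1.1] -/
theorem hasDim2Repr_linearBound (hH : HessianRankCodimTwo) (hU : UnitDichotomy) :
    ∃ C n₀ : ℕ, ∀ n ≥ n₀, ∀ m : ℕ, HasDim2Repr n m → n ≤ C * m := by
  obtain ⟨C₁, n₁, h₁⟩ := hasDim2Repr_sq_le_or_unipotent hH hU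
  obtain ⟨C₂, n₂, h₂⟩ := dualUnipotentRepr_linearBound
  refine ⟨max C₁ C₂, max n₁ n₂, fun n hn m hrep => ?_⟩
  rcases h₁ n (le_of_max_le_left hn) m hrep with h | h
  · calc n ≤ n ^ 2 := by nlinarith
      _ ≤ C₁ * m := h
      _ ≤ max C₁ C₂ * m := Nat.mul_le_mul_right _ (le_max_left _ _)
  · exact (h₂ n (le_of_max_le_right hn) m h).trans (Nat.mul_le_mul_right _ (le_max_right _ _))

/-- **Glue:** the disjunctive form together with `DualUnipotentBound` (the open stub) gives the crux
`TwoDimCoefficients` verbatim — re-typing the crux to the disjunctive or the linear form loses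
nothing of what the line proves. [folklore] -/
theorem twoDimCoefficients_of_disjunctive
    (hdis : ∃ C n₀ : ℕ, ∀ n ≥ n₀, ∀ m : ℕ, HasDim2Repr n m → n ^ 2 ≤ C * m ∨ DualUnipotentRepr n m)
    (hD : DualUnipotentBound) : TwoDimCoefficients := by
  obtain ⟨C₁, n₁, h₁⟩ := hdis
  obtain ⟨C₂, n₂, h₂⟩ := hD
  refine ⟨max C₁ C₂, max n₁ n₂, fun n hn m hrep => ?_⟩
  rcases h₁ n (le_of_max_le_left hn) m hrep with h | h
  · exact h.trans (Nat.mul_le_mul_right _ (le_max_left _ _))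
  · exact (h₂ n (le_of_max_le_right hn) m h).trans (Nat.mul_le_mul_right _ (le_max_right _ _))

/-- **The composition of the line, restated through the glue:** `HessianRankCodimTwo`,
`UnitDichotomy` and `DualUnipotentBound` give `TwoDimCoefficients`. [folklore] -/
theorem twoDimCoefficients_of_hyps (hH : HessianRankCodimTwo) (hU : UnitDichotomy)
    (hD : DualUnipotentBound) : TwoDimCoefficients :=
  twoDimCoefficients_of_disjunctive (hasDim2Repr_sq_le_or_unipotent hH hU) hD

/-! ### After `stub_unitDichotomy` (p580672): the same statements conditional on 8061 alone -/

/-- **The crux in DISJUNCTIVE form, conditional on `HessianRankCodimTwo` (stmt-8061) only:** every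
`(m, ≤ 2)`-representation of `per_n` (`n ≥ n₀`) has `n² ≤ C·m` or is a unipotent dual
representation.  (`UnitDichotomy` discharged by the landed `stub_unitDichotomy`.) [folklore] -/
theorem hasDim2Repr_sq_le_or_unipotent_of_hessianRankCodimTwo (hH : HessianRankCodimTwo) :
    ∃ C n₀ : ℕ, ∀ n ≥ n₀, ∀ m : ℕ, HasDim2Repr n m → n ^ 2 ≤ C * m ∨ DualUnipotentRepr n m :=
  hasDim2Repr_sq_le_or_unipotent hH stub_unitDichotomy

/-- **The LINEAR crux, conditional on `HessianRankCodimTwo` (stmt-8061) only:** two-dimensional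
coefficients buy at most a linear factor — every `(m, ≤ 2)`-representation of `per_n` (`n ≥ n₀`)
has `n ≤ C·m`. [cite: MignonRessayre2004, Thm. 1.1] -/
theorem hasDim2Repr_linearBound_of_hessianRankCodimTwo (hH : HessianRankCodimTwo) :
    ∃ C n₀ : ℕ, ∀ n ≥ n₀, ∀ m : ℕ, HasDim2Repr n m → n ≤ C * m :=
  hasDim2Repr_linearBound hH stub_unitDichotomy

/-- **The crux modulo its one open stub:** `HessianRankCodimTwo` (the dependency crux, by name) and
`DualUnipotentBound` (the isolated open sub-case) give `TwoDimCoefficients`; all other stubs of the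
line `dim2_cases` are tree theorems. [folklore] -/
theorem twoDimCoefficients_of_dualUnipotentBound (hH : HessianRankCodimTwo)
    (hD : DualUnipotentBound) : TwoDimCoefficients :=
  twoDimCoefficients_of_hyps hH stub_unitDichotomy hD

/-! ### Calibration of the linear form: it is in fact unconditional (degree count) -/

/-- **Size is at least degree, unconditionally.** Every `(m, ≤ 2)`-representation of `per_n` has
`n ≤ m`: the determinant of an affine `m × m` matrix over `R[x]` has total degree `≤ m`, the
functional `l` kills no coefficient that `per_n` has, and `per_n` has total degree `n`.  So the
LINEAR form of the crux carries no information beyond degree; the content of `TwoDimCoefficients`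
is the quadratic constant (and sits, after `stub_unitDichotomy`, exactly in `DualUnipotentBound`
plus the dependency `HessianRankCodimTwo`). [folklore] -/
theorem le_of_hasDim2Repr {n m : ℕ} (h : HasDim2Repr n m) : n ≤ m := by
  classical
  obtain ⟨R, _, _, _, -, l, A, hA, hcoeff⟩ := h
  have hdeg : A.det.totalDegree ≤ m := by
    refine (Literature.LinearAlgebra.Matrix.totalDegree_det_le A (fun _ => 1) fun i j => hA i j).trans ?_
    simp
  have hper : (perPoly (Fin n) ℂ).totalDegree = n := by
    rw [(totalDegree_perPoly_holds (n := Fin n) (k := ℂ) : (perPoly (Fin n) ℂ).totalDegree = _),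
      Fintype.card_fin]
  rw [← hper, MvPolynomial.totalDegree]
  refine Finset.sup_le fun d hd => ?_
  have hd' : d ∈ A.det.support := by
    rw [MvPolynomial.mem_support_iff] at hd ⊢
    intro h0
    apply hd
    rw [← hcoeff d, h0, map_zero]
  exact (MvPolynomial.le_totalDegree hd').trans hdeg

end Summit.ValiantsHypothesis.ValiantsHypothesis.Cruxes.TwoDimCoefficients.DimTwoCases

end
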